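import Summits.NavierStokesRegularity.FunctionalMining.HsEnergyBalance
import Summits.NavierStokesRegularity.FunctionalMining.VorticityMomentSaturatingLaw
import Summits.NavierStokesRegularity.FunctionalMining.HeatSieve
import HarnessLib

/-!
# FunctionalMining — the rows `EF.s | T_LD | G1` reduced to ONE static production estimate

Search for candidate a priori estimates; no regularity claim. Cell `pub-nsfunc`, prove seat
(gen 11). With the exact balance of `HsEnergyBalance`
(`dE_s/dt = N_s + ν V_s`, `V_s = −2E_{s+1}`, `N_s(v) = −2∫⟪(-Δ)^s v, (v·∇)v⟫`, every real `s ≥ 0`),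
the saturating law of the K0 row `EF.s | T_LD | G1`,

`dE_s/dt ≤ κ ν^{−γ_s} (2ℰ) E_s^{1 + 1/σ_s}`, `σ_s = 2s − 1`, `γ_s = (2s+1)/(2s−1)`

(the only dimensionally consistent exponents; `s = 1`: Lu–Doering `(1, 3)`, `s = 2`: palinstrophy
`(3, 5/3)`), is, for `s > 1/2`,

* IMPLIED by the single static estimate (the "located gap" of SIEVELD §3.6, here a typed `Prop`)
  `HsProductionBound s C : |N_s(v)| ≤ C (2ℰ)^{(2s−1)/(4s)} E_s^{1/2} E_{s+1}^{(2s+1)/(4s)}`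
  on smooth divergence-free zero-mean fields of `T³` — by the weighted Young inequality
  (`VorticityMoment.young_rpow`) with `a = (2s+1)/(4s)`, `a/(1−a) = γ_s`, `(1 + 1/σ_s)(1 − a) = 1/2`,
  giving `κ = C^{4s/(2s−1)}` (`saturatingLaw_torusHsEnergy_of_productionBound`); the expected proof of
  the estimate is `|N_s| ≤ ‖u‖_{Ḣ^{s+1}} ‖u ⊗ u‖_{Ḣ^s}` + a lattice product law
  `Ḣ^{s₁}·Ḣ^{s₂} ⊂ Ḣ^{s₁+s₂−3/2}` + outward interpolation (only the pair `(1,1) ↦ 1/2` is in the tree,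
  `TorusLatticeProductLaw`);
* and conversely EQUIVALENT at the datum to the static inequality
  `N_s(u₀) − 2ν E_{s+1}(u₀) ≤ κ ν^{−γ}(2ℰ)E_s^{1+1/σ}` for every `ν > 0` (Lemma 0 of the heat sieve,
  `static_of_saturatingLaw_torusHsEnergy`) — Theorem H itself cannot refute these rows since
  `V_s ≤ 0` (`hsViscousRate_nonpos`).

Row instances (conditional): `EF.s=3/4` at `(1/2, 5)`, `EF.s=5/4` at `(3/2, 7/3)`, `EF.s=3/2` at
`(2, 2)`. No verdict is moved by this file; it types what remains to be proved.
-/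

noncomputable section

open MeasureTheory Set Filter Topology Function
open scoped InnerProductSpace RealInnerProductSpace

namespace Summit.NavierStokesRegularity.FunctionalMining

open Literature.Analysis Literature.Analysis.FunctionSpaces Literature.Analysis.FluidPDE
open Literature.Analysis.FunctionSpaces.Torus Literature.Analysis.FluidPDE.Torus

/-- The flat three-torus, local notation. -/
local notation "𝕋³" => UnitAddTorus (Fin 3)
/-- Euclidean `ℝ³`, local notation. -/
local notation "E³" => EuclideanSpace ℝ (Fin 3)

/-! ## 1. The static production estimate (the located gap, typed) -/

/-- **The static production estimate for the row `EF.s` (located gap of SIEVELD §3.6, typed).**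
For every smooth divergence-free zero-mean field `v` on `T³`:
`|N_s(v)| ≤ C · (2ℰ(v))^{(2s−1)/(4s)} · E_s(v)^{1/2} · E_{s+1}(v)^{(2s+1)/(4s)}`, where
`N_s(v) = −2∫⟪(-Δ)^s v, (v·∇)v⟫` (`hsInertialRate`), `E_s = ‖v‖²_{Ḣˢ}` (`torusHsEnergy`). At `s = 1`
this is the classical `|∫ω·Sω| ≲ ‖∇u‖₂^{3/2}‖Δu‖₂^{3/2}`. Not proved in THIS file; STATUS (2026-08-21):
PROVED in the tree for every real `s > 1/2` — `exists_hsProductionBound (hs : 1/2 < s) : ∃ C ≥ 0,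
HsProductionBound s C` (`HsProductionBoundAllOrders.lean`, p256291; lattice trilinear estimate
`LatticeTrilinear` + split form `HsConvectionTrilinearSplit` + interpolation), with the explicit
`s = 1` anchor `hsProductionBound_one` (`HsProductionBoundOne.lean`, p251949, `C = 2(4/π⁴)^{1/4}`) and the
row instances `exists_hsProductionBound_three_quarters/_five_quarters/_three_halves`
(`HsProductionBoundRows.lean`, p255848); the `@[conjecture]` tag is kept only because this module is
upstream of those proofs. Search for candidate a priori estimates; no regularity claim — nothing is
asserted here. [ours; SIEVELD §3.6] -/
@[conjecture] def HsProductionBound (s C : ℝ) : Prop :=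
  ∀ v : 𝕋³ → E³, IsSmooth v → IsDivFree v → HasZeroMean v →
    |hsInertialRate s v| ≤ C * (2 * torusEnstrophy v) ^ ((2 * s - 1) / (4 * s)) *
      torusHsEnergy s v ^ (1 / 2 : ℝ) * torusHsEnergy (s + 1) v ^ ((2 * s + 1) / (4 * s))

/-! ## 2. Static ⇒ dynamic: the production estimate gives the row -/

/-- **`HsProductionBound s C` ⇒ the row `EF.s | T_LD | G1` with `κ = C^{4s/(2s−1)}`** (`s > 1/2`,
`C ≥ 0`): `dE_s/dt = N_s − 2νE_{s+1} ≤ |N_s| − νE_{s+1} ≤ C^{1/(1−a)} ν^{−a/(1−a)} (2ℰ)E_s^{1+1/σ}` by the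
weighted Young inequality with `a = (2s+1)/(4s)` (`a/(1−a) = (2s+1)/(2s−1)`,
`(1 − a)(1 + 1/(2s−1)) = 1/2`). [ours] -/
theorem saturatingLaw_torusHsEnergy_of_productionBound {s C : ℝ} (hs : 1 / 2 < s) (hC : 0 ≤ C)
    (h : HsProductionBound s C) :
    SaturatingLaw (d := Fin 3) (torusHsEnergy s) (2 * s - 1) ((2 * s + 1) / (2 * s - 1))
      (C ^ (4 * s / (2 * s - 1))) := by
  have hs0 : 0 ≤ s := by linarith
  have h4s : 0 < 4 * s := by linarith
  have h2s1 : 0 < 2 * s - 1 := by linarith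
  obtain ⟨e, he⟩ : ∃ e : ℝ, e = (2 * s + 1) / (4 * s) := ⟨_, rfl⟩
  have he0 : 0 < e := by rw [he]; positivity
  have he1 : e < 1 := by rw [he, div_lt_one h4s]; linarith
  have h1e : 1 - e = (2 * s - 1) / (4 * s) := by
    rw [he]; field_simp; ring
  have hγ : e / (1 - e) = (2 * s + 1) / (2 * s - 1) := by
    rw [h1e, he, div_div_div_cancel_right₀ h4s.ne']
  have hκ : 1 / (1 - e) = 4 * s / (2 * s - 1) := by
    rw [h1e, one_div_div]
  have hhalf : (1 + (2 * s - 1)⁻¹) * (1 - e) = 1 / 2 := by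
    rw [h1e]; field_simp; ring
  intro _ ν hν a b hab u p hsol hmean t ht
  have hut : IsSmooth (u t) := hsol.smooth_velocity.isSmooth_slice ht
  have hdiv : IsDivFree (u t) := hsol.divFree t ht
  have hD := hasDerivWithinAt_torusHsEnergy_NS hs0 hsol hab ht
  refine ⟨hD.differentiableWithinAt, ?_⟩
  rw [hD.derivWithin (uniqueDiffOn_Icc hab t ht)]
  show hsInertialRate s (u t) + ν * hsViscousRate s (u t) ≤
    C ^ (4 * s / (2 * s - 1)) * ν ^ (-((2 * s + 1) / (2 * s - 1))) *
      (2 * torusEnstrophy (u t)) * torusHsEnergy s (u t) ^ (1 + (2 * s - 1)⁻¹)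
  -- opaque names
  obtain ⟨N, hN⟩ : ∃ N : ℝ, N = hsInertialRate s (u t) := ⟨_, rfl⟩
  obtain ⟨I, hI⟩ : ∃ I : ℝ, I = torusHsEnergy (s + 1) (u t) := ⟨_, rfl⟩
  obtain ⟨Z, hZ⟩ : ∃ Z : ℝ, Z = 2 * torusEnstrophy (u t) := ⟨_, rfl⟩
  obtain ⟨F, hF⟩ : ∃ F : ℝ, F = torusHsEnergy s (u t) := ⟨_, rfl⟩
  obtain ⟨M, hM⟩ : ∃ M : ℝ, M = Z * F ^ (1 + (2 * s - 1)⁻¹) := ⟨_, rfl⟩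
  have hI0 : 0 ≤ I := by rw [hI]; exact torusHsEnergy_nonneg (by linarith) hut
  have hZ0 : 0 ≤ Z := by rw [hZ]; exact mul_nonneg (by norm_num) (torusEnstrophy_nonneg _)
  have hF0 : 0 ≤ F := by rw [hF]; exact torusHsEnergy_nonneg hs0 hut
  have hM0 : 0 ≤ M := by rw [hM]; exact mul_nonneg hZ0 (Real.rpow_nonneg hF0 _)
  have hV : hsViscousRate s (u t) = -2 * I := by rw [hsViscousRate, hI]
  -- the static bound in Young's form `|N| ≤ C I^e M^{1-e}`
  have hstat : |N| ≤ C * I ^ e * M ^ (1 - e) := by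
    have h1 := h (u t) hut hdiv (hmean t ht)
    rw [← hN, ← hZ, ← hF, ← hI, ← he] at h1
    have hMe : M ^ (1 - e) = Z ^ ((2 * s - 1) / (4 * s)) * F ^ (1 / 2 : ℝ) := by
      rw [hM, Real.mul_rpow hZ0 (Real.rpow_nonneg hF0 _), ← Real.rpow_mul hF0, hhalf, h1e]
    rw [hMe]
    calc |N| ≤ C * Z ^ ((2 * s - 1) / (4 * s)) * F ^ (1 / 2 : ℝ) * I ^ e := h1
      _ = C * I ^ e * (Z ^ ((2 * s - 1) / (4 * s)) * F ^ (1 / 2 : ℝ)) := by ring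
  have hY := VorticityMoment.young_rpow he0 he1 hC hI0 hM0 hν
  rw [hV, ← hN]
  have hNle : N ≤ |N| := le_abs_self N
  have hνI : 0 ≤ ν * I := mul_nonneg hν.le hI0
  have hbudget : C ^ (4 * s / (2 * s - 1)) * ν ^ (-((2 * s + 1) / (2 * s - 1))) *
      (2 * torusEnstrophy (u t)) * torusHsEnergy s (u t) ^ (1 + (2 * s - 1)⁻¹) =
      C ^ (1 / (1 - e)) * ν ^ (-(e / (1 - e))) * M := by
    rw [hκ, hγ, hM, ← hZ, ← hF]; ring
  rw [hbudget]
  linarith [hstat, hY]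

/-- **Row form with `∃ κ`.** [ours] -/
theorem exists_saturatingLaw_torusHsEnergy_of_productionBound {s C : ℝ} (hs : 1 / 2 < s) (hC : 0 ≤ C)
    (h : HsProductionBound s C) :
    ∃ κ : ℝ, SaturatingLaw (d := Fin 3) (torusHsEnergy s) (2 * s - 1) ((2 * s + 1) / (2 * s - 1)) κ :=
  ⟨_, saturatingLaw_torusHsEnergy_of_productionBound hs hC h⟩

/-! ## 3. Dynamic ⇒ static: Lemma 0 of the heat sieve for the family `EF.s` -/

/-- **Static reduction (Lemma 0) for `EF.s`.** If `SaturatingLaw (torusHsEnergy s) σ γ κ` holds on `T³`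
(`s ≥ 0`), then at every smooth divergence-free zero-mean datum and every `ν > 0`:
`N_s(u₀) − 2ν E_{s+1}(u₀) ≤ κ ν^{−γ} (2ℰ(u₀)) E_s(u₀)^{1+1/σ}` (`SaturatingLaw.initialRate_le` with the
exact initial rates `hasInitialRate_torusHsEnergy`). Since `V_s = −2E_{s+1} ≤ 0`, Theorem H
(`HeatSieve`) does not refute these rows. [ours; SIEVELD §0 Lemma 0] -/
theorem static_of_saturatingLaw_torusHsEnergy {s σ γ κ : ℝ} (hs : 0 ≤ s)
    (hF : SaturatingLaw (d := Fin 3) (torusHsEnergy s) σ γ κ) {ν : ℝ} (hν : 0 < ν)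
    {u₀ : 𝕋³ → E³} (hu₀ : IsSmooth u₀) (hdiv : IsDivFree u₀) (hmean : HasZeroMean u₀) :
    hsInertialRate s u₀ - 2 * ν * torusHsEnergy (s + 1) u₀ ≤
      κ * ν ^ (-γ) * (2 * torusEnstrophy u₀) * torusHsEnergy s u₀ ^ (1 + σ⁻¹) := by
  have h := hF.initialRate_le (hasInitialRate_torusHsEnergy hs) (by simp) hν hu₀ hdiv hmean
  rw [hsViscousRate] at h
  linarith

/-! ## 4. The three open rows, conditional on their production estimates -/

/-- **Row `EF.s=3/4 | T_LD | G1` (K0: `σ_F = 1/2`, `γ_F = 5`) from `HsProductionBound (3/4) C`**: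
`∃ κ, SaturatingLaw (torusHsEnergy (3/4)) (1/2) 5 κ`. Conditional; nothing asserted. [ours] -/
theorem hsEnergy_saturatingLaw_three_quarters_of_bound {C : ℝ} (hC : 0 ≤ C)
    (h : HsProductionBound (3 / 4) C) :
    ∃ κ : ℝ, SaturatingLaw (d := Fin 3) (torusHsEnergy (3 / 4)) (1 / 2) 5 κ := by
  obtain ⟨κ, hκ⟩ := exists_saturatingLaw_torusHsEnergy_of_productionBound (by norm_num) hC h
  have e1 : (2 : ℝ) * (3 / 4) - 1 = 1 / 2 := by norm_num
  have e2 : ((2 : ℝ) * (3 / 4) + 1) / (2 * (3 / 4) - 1) = 5 := by norm_num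
  rw [e2, e1] at hκ
  exact ⟨κ, hκ⟩

/-- **Row `EF.s=5/4 | T_LD | G1` (K0: `σ_F = 3/2`, `γ_F = 7/3`) from `HsProductionBound (5/4) C`**:
`∃ κ, SaturatingLaw (torusHsEnergy (5/4)) (3/2) (7/3) κ`. Conditional; nothing asserted. [ours] -/
theorem hsEnergy_saturatingLaw_five_quarters_of_bound {C : ℝ} (hC : 0 ≤ C)
    (h : HsProductionBound (5 / 4) C) :
    ∃ κ : ℝ, SaturatingLaw (d := Fin 3) (torusHsEnergy (5 / 4)) (3 / 2) (7 / 3) κ := by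
  obtain ⟨κ, hκ⟩ := exists_saturatingLaw_torusHsEnergy_of_productionBound (by norm_num) hC h
  have e1 : (2 : ℝ) * (5 / 4) - 1 = 3 / 2 := by norm_num
  have e2 : ((2 : ℝ) * (5 / 4) + 1) / (2 * (5 / 4) - 1) = 7 / 3 := by norm_num
  rw [e2, e1] at hκ
  exact ⟨κ, hκ⟩

/-- **Row `EF.s=3/2 | T_LD | G1` (K0: `σ_F = 2`, `γ_F = 2`) from `HsProductionBound (3/2) C`**:
`∃ κ, SaturatingLaw (torusHsEnergy (3/2)) 2 2 κ`. Conditional; nothing asserted. [ours] -/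
theorem hsEnergy_saturatingLaw_three_halves_of_bound {C : ℝ} (hC : 0 ≤ C)
    (h : HsProductionBound (3 / 2) C) :
    ∃ κ : ℝ, SaturatingLaw (d := Fin 3) (torusHsEnergy (3 / 2)) 2 2 κ := by
  obtain ⟨κ, hκ⟩ := exists_saturatingLaw_torusHsEnergy_of_productionBound (by norm_num) hC h
  have e1 : (2 : ℝ) * (3 / 2) - 1 = 2 := by norm_num
  have e2 : ((2 : ℝ) * (3 / 2) + 1) / (2 * (3 / 2) - 1) = 2 := by norm_num
  rw [e2, e1] at hκ
  exact ⟨κ, hκ⟩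

end Summit.NavierStokesRegularity.FunctionalMining
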